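import Literature.AnabelianGeometry.SemiGraphs.PSCCommonPrimeProofs
import Literature.AnabelianGeometry.SemiGraphs.PSCVertexQuotientNontrivialProofs
import Literature.AnabelianGeometry.SemiGraphs.PSCGraphicityEasyDirections
import HarnessLib

/-!
# [CombGC] Theorem 1.6 (ii) for general `Σ`: the degenerate datum on the trivial group, and the Ω-adapter

Mochizuki, *A combinatorial version of the Grothendieck conjecture*, Tohoku Math. J. **59** (2007)
[CombGC], Theorem 1.6 (ii), author's ms p. 13: "`α` is graphic if and only if it is graphically
filtration-preserving"; proof, p. 13 l.−5…−4: "we may assume `Σ = {l}`".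

The cell's kernel of Theorem 1.6 (ii) (sub-DAG `plan/L3/SUBDAG-CombGC-Thm16.md`, row T16-L00 (ii);
`graphicIffFiltrationPreserving_holds_of_inputs`, abc-iut-w4-d052) is typed at `Σ_G = Σ_H = {l}`; its
general-`Σ` closer (row T16-L04b (ii), abc-iut-w5-d174, shadow-graphicity on the maximal pro-`l`
quotients) needs a prime `l ∈ Σ_G ∩ Σ_H`, which over the interface `PSCDatum` ([CombGC] Def. 1.1 (ii),
abc-iut-L3-t4) — each datum carrying its own `Σ` — is a DISPLAYED hypothesis.  Companion of
`PSCCommonPrimeProofs.lean` (Theorem 1.6 (i)) and `PSCCommonPrimeUnrProofs.lean` (Theorem 1.6 (iii)),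
this proof-only file removes it for Theorem 1.6 (ii):

* for `Π_G` profinite and NONTRIVIAL the common prime is `exists_mem_sigma_inter_of_continuousMulEquiv`
  (`PSCCommonPrimeProofs.lean`);
* the degenerate datum on the TRIVIAL group (admitted by the interface, not by print) is settled
  directly: granted [CombGC] Rmk. 1.1.3 (`AbelianizedGrphRank`: `Π^grph` free of rank `n − i + 1`),
  Rmk. 1.3.1 (`NoncuspidalIffCuspFilTrivial`), connectedness of the coverings (`VertCountLeNodeCountSucc`:
  `i ≤ n + 1`) and Prop. 1.2 (i) (`VerticialOpenInterDeterminesVertex`), a datum on the trivial group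
  has ONE vertex, NO nodes and NO cusps (`isNoncuspidal_of_subsingleton`, `subsingleton_vertices_of_subsingleton`,
  `card_vertices_nodes_of_subsingleton`), so any two such data have isomorphic semi-graphs and every
  `α` between them is graphic (`isGraphic_of_subsingleton`), whence the typed iff
  (`graphicIffGraphicallyFiltrationPreserving_of_subsingleton`);
* **`graphicIffFiltrationPreserving_holds_of_commonPrimeVersion`** — the Ω-ADAPTER: any proof of the
  typed Theorem 1.6 (ii) for `Ω`-data displaying `∃ l ∈ Σ_G ∩ Σ_H` yields
  `GraphicIffFiltrationPreservingHolds Ω` ([CombGC] Thm. 1.6 (ii) AS TYPED, abc-iut-L3-t4's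
  `PSCGraphicity.lean`) with NO displayed hypothesis, granted profiniteness, `RankStatementsHold`,
  `VertCountLeNodeCountSuccHolds` and `OpenInterDeterminesComponentHolds` (all already among the
  closer's named inputs).

Proof-only (0 defs); plain profinite group theory over the interface; a FACT row is an assumption
label — nothing here asserts the printed claims for curves, and nothing here takes a side on
[IUTchIII] Cor. 3.12. [cite: MochizukiCombGC2007, Thm 1.6(ii) p.13] [cite: MochizukiCombGC2007, Rmk 1.1.3 p.8]
[cite: MochizukiCombGC2007, Rmk 1.3.1 p.10] [cite: MochizukiCombGC2007, Prop 1.2(i) p.8]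
-/

noncomputable section

namespace Literature.AnabelianGeometry.SemiGraphs

namespace PSCDatum

open scoped Pointwise
open SemiGraphOfAnabelioids (IsProSigmaCompletion)

universe u

variable {P : Type u} [Group P] [TopologicalSpace P] [IsTopologicalGroup P]
variable {P' : Type u} [Group P'] [TopologicalSpace P'] [IsTopologicalGroup P']

/-! ### The shape of a datum on the trivial group -/

section Trivial

variable (G : PSCDatum P)

/-- On the trivial group every covering has `M^cusp = 0` (all subgroups coincide), so [CombGC]
Rmk. 1.3.1 (`NoncuspidalIffCuspFilTrivial`) makes the datum noncuspidal: NO CUSPS.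
[cite: MochizukiCombGC2007, Rmk 1.3.1 p.10] -/
theorem isNoncuspidal_of_subsingleton [Subsingleton P] (hnc : G.NoncuspidalIffCuspFilTrivial) :
    G.graph.IsNoncuspidal :=
  hnc.mpr fun _ _ => Subsingleton.elim _ _

/-- No cusps on the trivial group (Rmk. 1.3.1). [cite: MochizukiCombGC2007, Rmk 1.3.1 p.10] -/
theorem isEmpty_cusps_of_subsingleton [Subsingleton P] (hnc : G.NoncuspidalIffCuspFilTrivial) :
    IsEmpty G.graph.C :=
  Fintype.card_eq_zero_iff.mp (G.isNoncuspidal_of_subsingleton hnc)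

omit [IsTopologicalGroup P] in
/-- On the trivial group any two verticial subgroups meet openly (everything is `⊥`), so [CombGC]
Prop. 1.2 (i) (`VerticialOpenInterDeterminesVertex`) leaves AT MOST ONE VERTEX.
[cite: MochizukiCombGC2007, Prop 1.2(i) p.8] -/
theorem subsingleton_vertices_of_subsingleton [Subsingleton P]
    (h12v : G.VerticialOpenInterDeterminesVertex) : Subsingleton G.graph.V := by
  refine ⟨fun v₁ v₂ => h12v v₁ v₂ 1 1 ?_⟩
  have huniv : ((((1 : ConjAct P) • G.vertGp v₁ ⊓ (1 : ConjAct P) • G.vertGp v₂).subgroupOf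
      ((1 : ConjAct P) • G.vertGp v₁) : Subgroup ((1 : ConjAct P) • G.vertGp v₁ : Subgroup P)) :
      Set ((1 : ConjAct P) • G.vertGp v₁ : Subgroup P)) = Set.univ :=
    Subsingleton.eq_univ_of_nonempty ⟨1, Subgroup.one_mem _⟩
  rw [huniv]; exact isOpen_univ

/-- On the trivial group, granted [CombGC] Rmk. 1.1.3 (`AbelianizedGrphRank`: `Π_G / M^vert` is the
pro-`Σ` completion of `ℤ^{n + 1 − i}`, so here `n + 1 − i = 0`), connectedness `i ≤ n + 1`
(`VertCountLeNodeCountSucc`) and Prop. 1.2 (i) (at most one vertex): EXACTLY ONE VERTEX and NO NODES.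
[cite: MochizukiCombGC2007, Rmk 1.1.3 p.8] -/
theorem card_vertices_nodes_of_subsingleton [Subsingleton P] (hgr : G.AbelianizedGrphRank)
    (hconn : G.VertCountLeNodeCountSucc) (h12v : G.VerticialOpenInterDeterminesVertex) :
    Fintype.card G.graph.V = 1 ∧ Fintype.card G.graph.N = 0 := by
  haveI := G.subsingleton_vertices_of_subsingleton h12v
  have hi : Fintype.card G.graph.V ≤ 1 := Fintype.card_le_one_iff_subsingleton.mpr ‹_›
  have htop : IsOpen (((⊤ : Subgroup P)) : Set P) := by rw [Subgroup.coe_top]; exact isOpen_univ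
  have hle : G.vertCount ⊤ ≤ G.nodeCount ⊤ + 1 := hconn ⊤ htop
  rw [vertCount_top, nodeCount_top] at hle
  -- the rank `n + 1 − i` vanishes, else `Π_G / M^vert` would be nontrivial
  have hrk : G.nodeCount ⊤ + 1 - G.vertCount ⊤ = 0 := by
    by_contra hne
    obtain ⟨l, hlS⟩ := G.sigma_nonempty
    have hl : l.Prime := G.sigma_prime l hlS
    haveI : ((G.vertFil ⊤).subgroupOf ⊤).Normal := by
      rw [Subsingleton.elim ((G.vertFil ⊤).subgroupOf ⊤) ⊤]; infer_instance
    obtain ⟨ι, hι⟩ := hgr ⊤ htop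
    obtain ⟨U, -, hUne, -⟩ := exists_open_ne_top_pow_mem ⟨0, Nat.pos_of_ne_zero hne⟩ hι hl hlS
    haveI : Subsingleton ((⊤ : Subgroup P) ⧸ (G.vertFil ⊤).subgroupOf ⊤) :=
      QuotientGroup.subsingleton_iff.mpr (Subsingleton.elim _ _)
    exact hUne (Subsingleton.elim _ _)
  rw [vertCount_top, nodeCount_top] at hrk
  unfold PSCSemiGraph.i PSCSemiGraph.n at hle hrk
  omega

/-- On the trivial group (granted Rmk. 1.1.3, connectedness, Prop. 1.2 (i)): one vertex.
[cite: MochizukiCombGC2007, Rmk 1.1.3 p.8] -/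
theorem nonempty_vertices_of_subsingleton [Subsingleton P] (hgr : G.AbelianizedGrphRank)
    (hconn : G.VertCountLeNodeCountSucc) (h12v : G.VerticialOpenInterDeterminesVertex) :
    Nonempty G.graph.V :=
  Fintype.card_pos_iff.mp (by rw [(G.card_vertices_nodes_of_subsingleton hgr hconn h12v).1]; omega)

/-- On the trivial group (granted Rmk. 1.1.3, connectedness, Prop. 1.2 (i)): no nodes.
[cite: MochizukiCombGC2007, Rmk 1.1.3 p.8] -/
theorem isEmpty_nodes_of_subsingleton [Subsingleton P] (hgr : G.AbelianizedGrphRank)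
    (hconn : G.VertCountLeNodeCountSucc) (h12v : G.VerticialOpenInterDeterminesVertex) :
    IsEmpty G.graph.N :=
  Fintype.card_eq_zero_iff.mp (G.card_vertices_nodes_of_subsingleton hgr hconn h12v).2

end Trivial

/-! ### Theorem 1.6 (ii) on the trivial group -/

section TrivialGraphic

variable (G : PSCDatum P) (H : PSCDatum P') (α : P ≃ₜ* P')

omit [IsTopologicalGroup P] [IsTopologicalGroup P'] in
/-- Two data with ONE vertex, NO nodes and NO cusps on groups of which the second is trivial: every
`α : Π_G ≅ Π_H` is graphic (the semi-graphs are isomorphic; all subgroups of `Π_H` coincide).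
[cite: MochizukiCombGC2007, Def 1.4(i) p.10] -/
theorem isGraphic_of_shape [Subsingleton P'] (hV : Nonempty G.graph.V) [Subsingleton G.graph.V]
    [IsEmpty G.graph.N] [IsEmpty G.graph.C] (hV' : Nonempty H.graph.V) [Subsingleton H.graph.V]
    [IsEmpty H.graph.N] [IsEmpty H.graph.C] : G.IsGraphic H α := by
  obtain ⟨v₀⟩ := hV
  obtain ⟨w₀⟩ := hV'
  haveI : Unique G.graph.V := uniqueOfSubsingleton v₀
  haveI : Unique H.graph.V := uniqueOfSubsingleton w₀
  refine ⟨{ vertEquiv := Equiv.ofUnique _ _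
            nodeEquiv := Equiv.equivOfIsEmpty _ _
            cuspEquiv := Equiv.equivOfIsEmpty _ _
            nodeEnds_comm := fun e => isEmptyElim e
            cuspEnd_comm := fun c => isEmptyElim c }, ?_, ?_, ?_⟩
  · exact fun v => ⟨1, Subsingleton.elim _ _⟩
  · exact fun e => isEmptyElim e
  · exact fun c => isEmptyElim c

/-- **[CombGC] Theorem 1.6 (ii) on the TRIVIAL group** (a degenerate datum the interface admits):
granted, for both data, Rmk. 1.1.3 (`AbelianizedGrphRank`), Rmk. 1.3.1 (`NoncuspidalIffCuspFilTrivial`),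
connectedness (`VertCountLeNodeCountSucc`) and Prop. 1.2 (i) (`VerticialOpenInterDeterminesVertex`),
both semi-graphs are a single vertex and every `α` is graphic; the typed
`GraphicIffGraphicallyFiltrationPreserving` follows (necessity being the general easy direction).
[cite: MochizukiCombGC2007, Thm 1.6(ii) p.13] -/
theorem graphicIffGraphicallyFiltrationPreserving_of_subsingleton [Subsingleton P]
    (hgr : G.AbelianizedGrphRank) (hnc : G.NoncuspidalIffCuspFilTrivial)
    (hconn : G.VertCountLeNodeCountSucc) (h12v : G.VerticialOpenInterDeterminesVertex)
    (hgr' : H.AbelianizedGrphRank) (hnc' : H.NoncuspidalIffCuspFilTrivial)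
    (hconn' : H.VertCountLeNodeCountSucc) (h12v' : H.VerticialOpenInterDeterminesVertex) :
    G.GraphicIffGraphicallyFiltrationPreserving H α := by
  haveI : Subsingleton P' := α.symm.injective.subsingleton
  haveI := G.subsingleton_vertices_of_subsingleton h12v
  haveI := H.subsingleton_vertices_of_subsingleton h12v'
  haveI := G.isEmpty_cusps_of_subsingleton hnc
  haveI := H.isEmpty_cusps_of_subsingleton hnc'
  haveI := G.isEmpty_nodes_of_subsingleton hgr hconn h12v
  haveI := H.isEmpty_nodes_of_subsingleton hgr' hconn' h12v'
  exact ⟨G.isGraphicallyFiltrationPreserving_of_isGraphic H α, fun _ =>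
    G.isGraphic_of_shape H α (G.nonempty_vertices_of_subsingleton hgr hconn h12v)
      (H.nonempty_vertices_of_subsingleton hgr' hconn' h12v')⟩

end TrivialGraphic

/-! ### The Ω-adapter for Theorem 1.6 (ii) with general `Σ` -/

section Origin

variable (Ω : PSCOrigin.{u})

/-- **Ω-ADAPTER for [CombGC] Theorem 1.6 (ii) with general `Σ`.**  Any proof of the typed
Theorem 1.6 (ii) (`GraphicIffGraphicallyFiltrationPreserving`) for all `Ω`-data that DISPLAYS a common
prime `∃ l ∈ Σ_G ∩ Σ_H` (the shape of the cell's shadow-graphicity route, row T16-L04b (ii) of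
`plan/L3/SUBDAG-CombGC-Thm16.md`) yields the typed statement `GraphicIffFiltrationPreservingHolds Ω` of
abc-iut-L3-t4's `PSCGraphicity.lean` with NO displayed hypothesis, granted profiniteness, Rmk. 1.1.3 /
1.3.1 (`RankStatementsHold`), connectedness (`VertCountLeNodeCountSuccHolds`) and Prop. 1.2 (i)
(`OpenInterDeterminesComponentHolds`): for nontrivial `Π_G` the common prime is automatic
(`exists_mem_sigma_inter_of_continuousMulEquiv`), and on the trivial group the iff holds outright.
[cite: MochizukiCombGC2007, Thm 1.6(ii) p.13] -/
theorem graphicIffFiltrationPreserving_holds_of_commonPrimeVersion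
    (hprof : ∀ ⦃Q : Type u⦄ [Group Q] [TopologicalSpace Q] [IsTopologicalGroup Q] (K : PSCDatum Q),
      Ω.IsOfPSCType K → CompactSpace Q ∧ TotallyDisconnectedSpace Q)
    (hrank : RankStatementsHold Ω) (hconn : VertCountLeNodeCountSuccHolds Ω)
    (h12 : OpenInterDeterminesComponentHolds Ω)
    (h : ∀ ⦃Q : Type u⦄ [Group Q] [TopologicalSpace Q] [IsTopologicalGroup Q]
      ⦃Q' : Type u⦄ [Group Q'] [TopologicalSpace Q'] [IsTopologicalGroup Q']
      (G : PSCDatum Q) (H : PSCDatum Q') (α : Q ≃ₜ* Q'),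
      Ω.IsOfPSCType G → Ω.IsOfPSCType H → (∃ l : ℕ, l ∈ G.Sigma ∧ l ∈ H.Sigma) →
        G.GraphicIffGraphicallyFiltrationPreserving H α) :
    Literature.AnabelianGeometry.SemiGraphs.PSCDatum.GraphicIffFiltrationPreservingHolds Ω := by
  intro Q _ _ _ Q' _ _ _ G H α hGΩ hHΩ
  obtain ⟨hcQ, htQ⟩ := hprof G hGΩ
  rcases subsingleton_or_nontrivial Q with hQ | hQ
  · exact G.graphicIffGraphicallyFiltrationPreserving_of_subsingleton H α (hrank G hGΩ).1
      (hrank G hGΩ).2.2.2 (hconn G hGΩ) (h12 G hGΩ).1 (hrank H hHΩ).1 (hrank H hHΩ).2.2.2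
      (hconn H hHΩ) (h12 H hHΩ).1
  · exact h G H α hGΩ hHΩ (G.exists_mem_sigma_inter_of_continuousMulEquiv H α)

end Origin

end PSCDatum

end Literature.AnabelianGeometry.SemiGraphs

end
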